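import Summits.QuantumFields.BalabanUV.T4Continuum.Support.NE7EtaBackgroundBinders

/-!
# NE7EtaBackgroundGaugeLetter — route #1 of the NE7 crux, stub S7 (NODE O, the BACKGROUND COORDINATE): the ONE new binder of the background
# coordinate (the smooth-gauge LETTER on the run-B minimiser under `hsector`) REDUCED to a SINGLE minimiser-free, K-free, Bałaban-free LATTICE
# LEMMA — «small plaquettes on a discrete 4-torus in the trivial sector ⇒ a global periodic gauge with every bond `exp A`, ‖A‖ ≤ C·(M⁻¹ + M·η)»

Cell `pub-balaban`, rung (B)+1 sub-cell t4, lineage `b2b-balaban-t4-ne7-p1`, generation 25 (CRUX PROVER NE7 #1, ruling e34b3e0c); crux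
skeleton `t4/skeletons/NE7-CRUX-R1.md` v1.7.5 §3sexies ∕ §5 (G5) item (3); sequel of `NE7EtaBackgroundBinders` (p259117).  HONEST FRAMING
(page 1): FIXED FINITE T⁴, rung (B)+1; NE7, NE3 NOT PRINTED in [Balaban1984PropagatorsI]–[Balaban1989LargeFieldII] and NOT PROVED here;
continuum YM on T⁴ ⇐ BetaPertH ∧ nine spine estimates (0/9 proved); BetaPertH ⇐ (D1) ∧ (D4) ∧ CAP+tail; G-an2-4 gates asym, D1 and NE2/3/4;
NOT infinite volume, NOT mass gap, NOT Clay.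

WHY.  After p259117 the background coordinate of NODE O costs, beyond row NE3's own binders, EXACTLY ONE new binder: `hletter` — every
`Regular 4 L N b g (K+1)` run-B minimiser of a datum of `dom` admits, IF `n·N²·ε ≤ c₀`, a unitary `N·L^{K+1}`-periodic gauge in which it is
bondwise `exp A_B` with `sup‖A_B‖ ≤ σ_B·θ^{6(K+1)}`.  The crux refuter (F32) priced it «LOCAL printed-TYPE ([Balaban1985Variational] Thm 1 (9)
p. 279: cube of side `2ML^jη`, gauge on a neighbourhood of the cube; [Balaban1985PropagatorsII] (1.128)–(1.129) p. 98) + UNPRINTED torus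
globalisation (comb gauge + holonomy spreading), satisfiable only in the trivial flux∕Lüscher sector».  THIS FILE shows that the letter
needs NOTHING about minimisers, nothing about Bałaban's averages and nothing K-dependent: it follows from ONE lattice-gauge lemma about
ARBITRARY unitary periodic small-field configurations on the discrete 4-torus, displayed as the hypothesis `hglob` (NOT a `def`, NOT a
Literature fact, asserted nowhere; filed as «INTERFACE REQUEST NE7: torusSmallFieldGlobalGauge» in HOME/INBOX.md by this generation):
  `hglob`: for every period `M ≥ 1` and plaquette radius `η ≥ 0` with the SECTOR∕SIZE CONDITION `n·M²·η ≤ c₀`, every unitary `M`-periodic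
  `U` with `SmallField U η` has a unitary `M`-periodic gauge `u` and `A` with `U^u = exp A` bondwise and `‖A_b‖ ≤ C·(M⁻¹ + M·η)` everywhere
  (`c₀`, `C` constants depending on `n` only; sketch, NOT in print as such: comb gauge on the fundamental box — interior bonds within `3Mη` of
  `1` by plaquette telescoping; the four families of wrap bonds = Polyakov holonomies, arbitrary but transversally `O(Mη)`-slowly varying and
  pairwise commuting up to the 2-torus fluxes `O(M²η) ≤ O(c₀∕n)`; under the sector condition the `n` eigenvalues of all holonomies avoid a
  common arc, so ONE branch of the matrix logarithm serves, and the position-dependent spreading `g = exp(−(x_μ∕M)·log W_μ)` direction by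
  direction costs `O(‖log W‖∕M) = O(M⁻¹)` per bond plus `O(Mη)` from the transverse variation — the textbook «maximal-tree ∕ complete axial
  gauge» (e.g. DeGrand–DeTar; Creutz ch. 8) carries the first half only).
WHAT ([folklore]; 0 def).  **`hletter_of_torusGauge`**: `hglob` (with constants `c₀`, `C`) + `0 ≤ b ≤ ε` ⟹ the binder `hletter` of
`NE7EtaBackgroundBinders.hexB_of_refine_regular_letter` ∕ `hclose_of_refine_regular_letter` with `σ_B := C·(N⁻¹ + N·b)` — take `M := N·L^{K+1}`,
`η := b∕(L^{K+1})²` (the `Regular` data: unitary, periodic, small field), so that `n·M²·η = n·N²·b ≤ n·N²·ε ≤ c₀` is EXACTLY the displayed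
`hsector` and `C·(M⁻¹ + Mη) = C·(N⁻¹ + N·b)·L^{−(K+1)} = σ_B·θ^{6(K+1)}` (`θ⁶ = L⁻¹`).  So `σ_B = σ_B(N) = C·(N⁻¹ + N·b)`, K-FREE, as the refuter
predicted (≍ `B₃Nε₁`), and the sector constant is the lemma's.
CONSEQUENCE FOR THE BILL (G5) item (3): the LETTER = ONE kernel-provable finite lattice lemma (no analysis of [Balaban1985Variational] needed;
size M–L in Lean: comb gauge, telescoping, a branch of the matrix logarithm on a sector, Lipschitz bounds) — requested as a NAMED interface.
HONEST.  `hglob` is a HYPOTHESIS (unproved here, unprinted as stated); composition only; nothing of NE3∕NE7 discharged; 0 def; 0 sorry.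
-/

set_option autoImplicit false

open scoped BigOperators Matrix Matrix.Norms.L2Operator
open Finset NormedSpace

namespace Summit.QuantumFields.BalabanUV.T4Continuum.NE7EtaBackgroundGaugeLetter

open Literature.MathematicalPhysics.QuantumFieldTheory.Balaban1983to89
open B7Prop1Explicit B7Prop2Explicit
open T4AveragingDeficitWall hiding Site Plane Plaq Bond
open T4AveragingDeficitWallBoundary (periodBox IsPeriodicCfg)
open MinimalActionSandwich (IsMinimiser)
open MinimalActionRate (Regular sfClass)
open NE3EnergyShapes (IsUnitarySite IsPeriodicSite)

noncomputable section

variable {n : Type} [Fintype n] [DecidableEq n] [Nonempty n]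

/-- **THE SMOOTH-GAUGE LETTER OF NODE O's BACKGROUND COORDINATE FROM ONE LATTICE LEMMA** (module docstring): `hglob` — global periodic
small gauge for unitary `M`-periodic small-field configurations on the discrete 4-torus in the sector `n·M²·η ≤ c₀`, bound `C·(M⁻¹ + M·η)` —
and `0 ≤ b ≤ ε` give the binder `hletter` of `NE7EtaBackgroundBinders.hclose_of_refine_regular_letter` with `σ_B = C·(N⁻¹ + N·b)` (K-free) and the
displayed sector condition `n·N²·ε ≤ c₀`.  The minimiser hypothesis is NOT used (only `Regular`: unitary, periodic, small field). [folklore] -/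
theorem hletter_of_torusGauge {L N : ℕ} (hL : 2 ≤ L) (hN : 1 ≤ N) {θ : ℝ} (hθ6 : θ ^ 6 = ((L : ℝ))⁻¹)
    {ε b g c₀ C : ℝ} (hb : 0 ≤ b) (hbε : b ≤ ε)
    (hglob : ∀ M : ℕ, 1 ≤ M → ∀ η : ℝ, 0 ≤ η → (Fintype.card n : ℝ) * (M : ℝ) ^ 2 * η ≤ c₀ →
      ∀ U : Site 4 → Fin 4 → (Matrix n n ℂ)ˣ, IsUnitaryCfg U → IsPeriodicCfg U (M : ℤ) → SmallField U η →
        ∃ u : Site 4 → (Matrix n n ℂ)ˣ, IsUnitarySite u ∧ IsPeriodicSite u (M : ℤ) ∧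
          ∃ A : Site 4 → Fin 4 → Matrix n n ℂ, ∀ (x : Site 4) (κ : Fin 4),
            ((gaugeAct u U x κ : (Matrix n n ℂ)ˣ) : Matrix n n ℂ) = exp (A x κ) ∧ ‖A x κ‖ ≤ C * (((M : ℝ))⁻¹ + (M : ℝ) * η))
    {dom : Set (Site 4 → Fin 4 → (Matrix n n ℂ)ˣ)} :
    ∀ K : ℕ, 1 ≤ K → ∀ v ∈ dom, ∀ UB : Site 4 → Fin 4 → (Matrix n n ℂ)ˣ,
      IsMinimiser 4 (sfClass 4 L N ε) L N (K + 1) v UB → Regular 4 L N b g (K + 1) UB →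
        (Fintype.card n : ℝ) * (N : ℝ) ^ 2 * ε ≤ c₀ →
        ∃ uB : Site 4 → (Matrix n n ℂ)ˣ, IsUnitarySite uB ∧ IsPeriodicSite uB ((N * L ^ (K + 1) : ℕ) : ℤ) ∧
          ∃ AB : Site 4 → Fin 4 → Matrix n n ℂ, ∀ (x : Site 4) (κ : Fin 4),
            ((gaugeAct uB UB x κ : (Matrix n n ℂ)ˣ) : Matrix n n ℂ) = exp (AB x κ) ∧
              ‖AB x κ‖ ≤ (C * (((N : ℝ))⁻¹ + (N : ℝ) * b)) * θ ^ (6 * (K + 1)) := by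
  intro K _ v _ UB _ hreg hsec
  have hL0 : (0 : ℝ) < L := by exact_mod_cast (by omega : 0 < L)
  have hN0 : (0 : ℝ) < N := by exact_mod_cast (by omega : 0 < N)
  have hn0 : (0 : ℝ) ≤ (Fintype.card n : ℝ) := by positivity
  set M : ℕ := N * L ^ (K + 1) with hM
  have hM1 : 1 ≤ M := Nat.one_le_iff_ne_zero.mpr (by positivity)
  have hMr : (M : ℝ) = (N : ℝ) * (L : ℝ) ^ (K + 1) := by rw [hM]; push_cast; ring
  have hLK : (0 : ℝ) < (L : ℝ) ^ (K + 1) := by positivity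
  set η : ℝ := b / ((L : ℝ) ^ (K + 1)) ^ 2 with hη
  have hη0 : 0 ≤ η := div_nonneg hb (by positivity)
  -- the sector condition in lattice units: `n·M²·η = n·N²·b ≤ n·N²·ε ≤ c₀`
  have hsecM : (Fintype.card n : ℝ) * (M : ℝ) ^ 2 * η ≤ c₀ := by
    have e : (Fintype.card n : ℝ) * (M : ℝ) ^ 2 * η = (Fintype.card n : ℝ) * (N : ℝ) ^ 2 * b := by
      rw [hMr, hη]; field_simp
    rw [e]
    exact le_trans (mul_le_mul_of_nonneg_left hbε (by positivity)) hsec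
  obtain ⟨u, hu, huP, A, hA⟩ := hglob M hM1 η hη0 hsecM UB hreg.unitary hreg.periodic hreg.small
  refine ⟨u, hu, huP, A, fun x κ => ⟨(hA x κ).1, (hA x κ).2.trans (le_of_eq ?_)⟩⟩
  -- `C·(M⁻¹ + M·η) = C·(N⁻¹ + N·b)·L^{−(K+1)} = C·(N⁻¹ + N·b)·θ^{6(K+1)}`
  have e6 : θ ^ (6 * (K + 1)) = ((L : ℝ) ^ (K + 1))⁻¹ := by rw [pow_mul, hθ6, inv_pow]
  rw [e6, hMr, hη]
  field_simp

end

end Summit.QuantumFields.BalabanUV.T4Continuum.NE7EtaBackgroundGaugeLetter
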